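import Mathlib
import Summits.ResolutionOfSingularities.ResolutionOfSingularities.Theorems.RadicialJungCleanModelsCleanProp44SideFamilyGeneralExponents
import Summits.ResolutionOfSingularities.ResolutionOfSingularities.Theorems.RadicialJungCleanModelsCleanProp44NearLineVertex
import HarnessLib

/-!
# Route `RadicialJung`, crux `CleanModels` (stmt-ResolutionOfSingularities-15917), line `Sketch` rev 35, stub 6 `stub_cleanProp44` (X44c):
# INSERTION AT A VERTEX — after blowing up a corner point, the strict transform of a transversal curve has no corner and no tangency obstruction

Seat decomp-res-hand-2 g19 (structural hand).  Brick (vi) of hand-2 g18's census (`Cruxes/CleanModels/Lines/Sketch-memo-hand2-g18-stubs-5-7.md` §2 (d)):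
the local step of the δ-descent for the VERTEX obstruction of ✓ `cleanPermissibleAt_nearLine_or_vertex_or_cross` — a regular curve germ `N = (c_{i₀}, z)`
through a point `x` with `𝔪_x = (c₀, c₁, c₂)`, the line of `G` presented by `V · ∏_k c_k^{a_k}` (ARBITRARY exponents: along a chain the component
`c_{i₀}` containing `N` is typically an older exceptional divisor with `p ∣ a_{i₀}`), `N` lying in `V(c_{i₀})` and TRANSVERSAL to the two other sides
(`(z, c_k, c_{i₀}) = 𝔪_x` for `k ≠ i₀` — the vertex configuration «`m_{k₁}, m_{k₂} ∉ 𝔪_x`»; `N` is then NOT clean-permissible at `x` in general,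
✓ `not_cleanPermissibleAt_diagonal_cornerWitness`).  INSERT: blow up the point `x` (`σ : X' → X` with `J_x = 𝔪_x`), and let `x' ∈ σ⁻¹(x)` lie on the
strict transforms of `V(c_{i₀})` and of `V(z)`: `σ^♯ c_{i₀} = E · ε`, `σ^♯ z = E · ζ` with `ε, ζ ∈ 𝔪_{x'}`, `(E) = 𝔪_x 𝒪_{X',x'}`.  Then:

* `cleanPermissibleAt_strictTransform_of_vertex_or_birth` — `(E, ε, ζ) = 𝔪_{x'}` (the strict transform `N' = (ε, ζ)` of `N` is a regular curve germ
  through `x'`, inside the strict transform `V(ε)` of `V(c_{i₀})`, TRANSVERSAL to the new exceptional divisor `V(E)`); the two other sides do NOT pass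
  through `x'` (their fractions are units); the transform reads `U · ε^{a_{i₀}} · E^{Σ a}`; and the line of `σ^♯ G` is CLEAN-PERMISSIBLE at `x'` for `N'`
  unless `p ∣ a_{i₀}`, `p ∣ Σ_k a_k` and `U` fails the non-birth test for `N'` — NO vertex and NO tangency obstruction survive the insertion
  (✓ `cleanPermissibleAt_or_obstruction_of_sideFamily_general` with the single transversal side `E`).
* `cleanPermissibleAt_strictTransform_of_vertex` — in particular `p ∤ a_{i₀}` or `p ∤ Σ a_k` ⟹ clean-permissible after ONE insertion.
* plumbing: `isRsopPart_vecCons_three_of_span_triple`, `not_mem_span_pair_sup_sq_of_span_triple`, `span_range_append_elim0_eq`.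

Honest framing: OURS; the termination measure of insertion chains (memo g18 §2 (d) (iii): the births invariant `δ*` when `p ∣ a_{i₀}`, `p ∣ Σ a`) is NOT
addressed.  Nothing here proves X44c, any case of `CleanModels`, or resolution of singularities in characteristic `p`.  Setting only:
[cite: CossartPiltant2008, Lemma 4.3 (5); Prop. 4.4 (proof, p. 11)] [cite: Piltant2013, §2 Axiom 4] [cite: GortzWedhorn2020, Prop. 13.91].
-/

noncomputable section

set_option linter.dupNamespace false -- mandated namespace of this single-conjunct summit

open IsLocalRing CategoryTheory AlgebraicGeometry
open Literature.AlgebraicGeometry.Resolution Literature.AlgebraicGeometry.Motives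

namespace Summit.ResolutionOfSingularities.ResolutionOfSingularities.Theorems.RadicialJung.CleanModels

universe u

/-! ## §0 Plumbing -/

section Plumbing

variable {R : Type u} [CommRing R]

/-- A generating triple of `𝔪` in a `3`-dimensional regular local ring is a regular system of parameters. [cite: Matsumura1987, Thm. 14.2] -/
theorem isRsopPart_vecCons_three_of_span_triple [IsLocalRing R] (hR : IsRegularLocalRing R) (hdim : ringKrullDim R = 3) {a b c : R}
    (h : Ideal.span ({a, b, c} : Set R) = maximalIdeal R) : IsRsopPart ![a, b, c] := by
  refine ⟨hR, 0, Fin.elim0, by rw [hdim]; norm_cast, ?_⟩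
  have hr : Set.range ![a, b, c] = {a, b, c} := by
    ext t
    simp only [Set.mem_range, Set.mem_insert_iff, Set.mem_singleton_iff]
    constructor
    · rintro ⟨i, rfl⟩
      fin_cases i <;> simp
    · rintro (rfl | rfl | rfl)
      exacts [⟨0, rfl⟩, ⟨1, rfl⟩, ⟨2, rfl⟩]
  rw [Set.range_eq_empty Fin.elim0, Set.union_empty, hr, h]

/-- From a generating triple `(a, b, c) = 𝔪` of a `3`-dimensional regular local ring: `c ∉ (a, b) + 𝔪²`. [cite: Matsumura1987, Thm. 14.2] -/
theorem not_mem_span_pair_sup_sq_of_span_triple [IsLocalRing R] (hR : IsRegularLocalRing R) (hdim : ringKrullDim R = 3) {a b c : R}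
    (h : Ideal.span ({a, b, c} : Set R) = maximalIdeal R) : c ∉ Ideal.span ({a, b} : Set R) ⊔ maximalIdeal R ^ 2 := by
  have h3 : IsRsopPart (Fin.append ![a, b] ![c]) := by
    have happ : (Fin.append ![a, b] ![c] : Fin 3 → R) = ![a, b, c] := by
      funext t; fin_cases t <;> rfl
    rw [happ]
    exact isRsopPart_vecCons_three_of_span_triple hR hdim h
  have h4 := append_right_not_mem_span_sup_sq h3 0
  have hr : Set.range ![a, b] = {a, b} := by
    ext t
    simp only [Set.mem_range, Set.mem_insert_iff, Set.mem_singleton_iff]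
    constructor
    · rintro ⟨i, rfl⟩
      fin_cases i <;> simp
    · rintro (rfl | rfl)
      exacts [⟨0, rfl⟩, ⟨1, rfl⟩]
  rw [hr] at h4
  simpa using h4

end Plumbing

/-! ## §1 Insertion at a vertex -/

section Scheme

variable {p : ℕ} {X X' : Scheme.{u}} [IsIntegral X] [IsIntegral X'] {σ : X' ⟶ X} [IsDominant σ] {J : X.IdealSheafData}

/-- Bookkeeping for point centres: `Set.range (Fin.append c Fin.elim0) = Set.range c`. [folklore] -/
theorem span_range_append_elim0_eq {R : Type u} [CommRing R] {d : ℕ} (c : Fin d → R) :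
    Ideal.span (Set.range (Fin.append c Fin.elim0)) = Ideal.span (Set.range c) := by
  rw [Fin.append_elim0]
  have hsurj : Function.Surjective (Fin.cast (Nat.add_zero d)) := fun i => ⟨Fin.cast (Nat.add_zero d).symm i, Fin.ext rfl⟩
  rw [hsurj.range_comp]

set_option maxHeartbeats 1600000 in
-- two normal forms and a side-family classification at one point
/-- **INSERTION AT A VERTEX: the strict transform of a transversal curve through a corner point is clean-permissible at the new point, or the new
point is a birth.**  See the module docstring. [cite: CossartPiltant2008, Lemma 4.3 (5); Prop. 4.4 (proof, p. 11)] [cite: Piltant2013, §2 Axiom 4] -/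
theorem cleanPermissibleAt_strictTransform_of_vertex_or_birth [Fact p.Prime] [CharP X'.functionField p] (hσ : IsBlowup σ J) (x' : X')
    (hR : IsRegularLocalRing (X.presheaf.stalk (σ x'))) (c : Fin 3 → X.presheaf.stalk (σ x'))
    (hc : Ideal.span (Set.range c) = maximalIdeal (X.presheaf.stalk (σ x')))
    (hdim : ringKrullDim (X.presheaf.stalk (σ x')) = (3 : ℕ)) (hJ : stalkIdeal J (σ x') = maximalIdeal (X.presheaf.stalk (σ x')))
    {G : X.functionField} {cc : Fin p → X.functionField} (hcc : ∃ j : Fin p, (j : ℕ) ≠ 0 ∧ cc j ≠ 0)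
    {V : X.presheaf.stalk (σ x')} (hV : IsUnit V) (a : Fin 3 → ℕ)
    (hrep : (∑ j : Fin p, cc j ^ p * G ^ (j : ℕ)) = RatFn.toFunctionField (σ x') (V * ∏ k, c k ^ a k))
    (i₀ : Fin 3) {z : X.presheaf.stalk (σ x')}
    (hz : ∀ k, k ≠ i₀ → Ideal.span ({z, c k, c i₀} : Set (X.presheaf.stalk (σ x'))) = maximalIdeal (X.presheaf.stalk (σ x')))
    (hdim' : ringKrullDim (X'.presheaf.stalk x') = 3) {E ε ζ : X'.presheaf.stalk x'}
    (hE : Ideal.span {E} = (maximalIdeal (X.presheaf.stalk (σ x'))).map (σ.stalkMap x').hom)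
    (hε : (σ.stalkMap x').hom (c i₀) = E * ε) (hεm : ε ∈ maximalIdeal (X'.presheaf.stalk x'))
    (hζ : (σ.stalkMap x').hom z = E * ζ) (hζm : ζ ∈ maximalIdeal (X'.presheaf.stalk x')) :
    Ideal.span ({E, ε, ζ} : Set (X'.presheaf.stalk x')) = maximalIdeal (X'.presheaf.stalk x') ∧
    (∀ k, k ≠ i₀ → Ideal.span {(σ.stalkMap x').hom (c k)} = (maximalIdeal (X.presheaf.stalk (σ x'))).map (σ.stalkMap x').hom) ∧
    ∃ U : X'.presheaf.stalk x', IsUnit U ∧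
      (∑ j : Fin p, RatFn.functionFieldMap σ (cc j) ^ p * RatFn.functionFieldMap σ G ^ (j : ℕ)) =
        RatFn.toFunctionField x' (U * ε ^ a i₀ * E ^ (∑ k, a k)) ∧
      (CleanPermissibleAt p (RatFn.toFunctionField x') (RatFn.functionFieldMap σ G) (Ideal.span ({ε, ζ} : Set (X'.presheaf.stalk x'))) ∨
        (p ∣ a i₀ ∧ p ∣ ∑ k, a k ∧
          ¬ ((∀ c' : X'.presheaf.stalk x', U - c' ^ p ∉ maximalIdeal (X'.presheaf.stalk x')) ∨
            (∃ c' : X'.presheaf.stalk x', U - c' ^ p ∈ maximalIdeal (X'.presheaf.stalk x') ∧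
              U - c' ^ p ∉ Ideal.span ({ε, ζ} : Set (X'.presheaf.stalk x')) ⊔ maximalIdeal (X'.presheaf.stalk x') ^ 2) ∨
            (∃ c' : X'.presheaf.stalk x', U - c' ^ p ∈ Ideal.span ({ε, ζ} : Set (X'.presheaf.stalk x')) ∧
              U - c' ^ p ∉ maximalIdeal (X'.presheaf.stalk x') ^ 2)))) := by
  classical
  -- bookkeeping for the point centre
  have hdim0 : ringKrullDim (X.presheaf.stalk (σ x')) = ((3 + 0 : ℕ) : WithBot ℕ∞) := by rw [Nat.add_zero]; exact hdim
  have hdim3 : ringKrullDim (X.presheaf.stalk (σ x')) = 3 := by rw [hdim]; norm_cast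
  have hz0 : Ideal.span (Set.range (Fin.append c Fin.elim0)) = maximalIdeal (X.presheaf.stalk (σ x')) := by
    rw [span_range_append_elim0_eq, hc]
  have hcJ : Ideal.span (Set.range c) = stalkIdeal J (σ x') := hc.trans hJ.symm
  have hcm : ∀ k, c k ∈ maximalIdeal (X.presheaf.stalk (σ x')) := fun k => hc ▸ Ideal.subset_span ⟨k, rfl⟩
  -- (I) the normal form of the representative at `x'`
  obtain ⟨i, uf, m, jJ, hrel, hufi, hjJ, hch, hcomplete, hrsop, U, hU, -, heq⟩ :=
    exists_transform_normalForm_of_isBlowup hσ x' hR c Fin.elim0 hz0 hdim0 hcJ a Fin.elim0 hV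
  simp only [Finset.univ_eq_empty, Finset.prod_empty, mul_one] at heq
  have hR' : IsRegularLocalRing (X'.presheaf.stalk x') := hrsop.isRegularLocalRing
  haveI := isDomain_of_isRegularLocalRing (X'.presheaf.stalk x')
  have hei : (σ.stalkMap x').hom (c i) ≠ 0 := by simpa using hrsop.ne_zero 0
  have hEi : Ideal.span {(σ.stalkMap x').hom (c i)} = (maximalIdeal (X.presheaf.stalk (σ x'))).map (σ.stalkMap x').hom := by
    rw [← hc]; exact span_singleton_eq_map_span_of_rel _ c i uf hrel
  obtain ⟨v, hv⟩ : Associated E ((σ.stalkMap x').hom (c i)) := Ideal.span_singleton_eq_span_singleton.mp (hE.trans hEi.symm)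
  have hE0 : E ≠ 0 := left_ne_zero_of_mul (hv.symm ▸ hei)
  -- the side `c_{i₀}` passes through `x'`: `uf_{i₀} = v⁻¹ ε`
  have hufi₀ : uf i₀ = ↑v⁻¹ * ε := by
    have h1 : E * (↑v * uf i₀) = E * ε := by rw [← mul_assoc, hv, ← hrel, hε]
    rw [← mul_left_cancel₀ hE0 h1, ← mul_assoc, Units.inv_mul, one_mul]
  have hufi₀m : uf i₀ ∈ maximalIdeal (X'.presheaf.stalk x') := by rw [hufi₀]; exact Ideal.mul_mem_left _ _ hεm
  have hii₀ : i ≠ i₀ := by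
    rintro rfl
    rw [hufi] at hufi₀m
    exact (maximalIdeal.isMaximal _).ne_top (Ideal.eq_top_of_isUnit_mem _ hufi₀m isUnit_one)
  obtain ⟨q₀, hq₀⟩ := hcomplete i₀ (Ne.symm hii₀) hufi₀m
  -- the third side `c_{k'}` does NOT pass through `x'`
  obtain ⟨k', hk'i, hk'i₀, huniv⟩ := exists_third_fin_three i i₀ hii₀
  have hck' : c k' ∈ Ideal.span ({z, c i, c i₀} : Set (X.presheaf.stalk (σ x'))) := by rw [hz i hii₀]; exact hcm k'
  obtain ⟨μ, y, hy, hck'eq⟩ := Ideal.mem_span_insert.mp hck'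
  obtain ⟨lam, ν, hyeq⟩ := Ideal.mem_span_pair.mp hy
  have hnot : c k' ∉ Ideal.span ({z, c i₀} : Set (X.presheaf.stalk (σ x'))) ⊔ maximalIdeal (X.presheaf.stalk (σ x')) ^ 2 := by
    have h1 : Ideal.span ({z, c i₀, c k'} : Set (X.presheaf.stalk (σ x'))) = maximalIdeal (X.presheaf.stalk (σ x')) := by
      rw [← hz k' hk'i₀]
      congr 1
      ext t
      simp only [Set.mem_insert_iff, Set.mem_singleton_iff]
      tauto
    exact not_mem_span_pair_sup_sq_of_span_triple hR hdim3 h1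
  have hlam : IsUnit lam := by
    by_contra hlam
    apply hnot
    rw [hck'eq, ← hyeq]
    refine Ideal.add_mem _ (Ideal.mem_sup_left (Ideal.mul_mem_left _ _ (Ideal.subset_span (by simp))))
      (Ideal.add_mem _ (Ideal.mem_sup_right ?_) (Ideal.mem_sup_left (Ideal.mul_mem_left _ _ (Ideal.subset_span (by simp)))))
    rw [pow_two]
    exact Ideal.mul_mem_mul ((mem_maximalIdeal _).mpr hlam) (hcm i)
  have hEeq : E = (σ.stalkMap x').hom (c i) * ↑v⁻¹ := by rw [← hv, mul_assoc, Units.mul_inv, mul_one]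
  have hufk' : uf k' ∉ maximalIdeal (X'.presheaf.stalk x') := by
    intro hmem
    have h1 : (σ.stalkMap x').hom (c i) * uf k' =
        (σ.stalkMap x').hom (c i) * ((σ.stalkMap x').hom lam + ((σ.stalkMap x').hom μ * (↑v⁻¹ * ζ) + (σ.stalkMap x').hom ν * uf i₀)) := by
      rw [← hrel k', hck'eq, ← hyeq, map_add, map_add, map_mul, map_mul, map_mul, hζ, hrel i₀, hEeq]
      ring
    have h2 := mul_left_cancel₀ hei h1
    have h3 : (σ.stalkMap x').hom lam ∈ maximalIdeal (X'.presheaf.stalk x') := by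
      have h4 : (σ.stalkMap x').hom lam = uf k' - ((σ.stalkMap x').hom μ * (↑v⁻¹ * ζ) + (σ.stalkMap x').hom ν * uf i₀) := by
        rw [h2]; ring
      rw [h4]
      exact Ideal.sub_mem _ hmem (Ideal.add_mem _ (Ideal.mul_mem_left _ _ (Ideal.mul_mem_left _ _ hζm)) (Ideal.mul_mem_left _ _ hufi₀m))
    exact mem_nonunits_iff.mp ((mem_maximalIdeal _).mp h3) (hlam.map _)
  -- every charged index is `i₀`
  have hall_q : ∀ q, (jJ q).1 = i₀ := by
    intro q
    rcases huniv (jJ q).1 with h | h | h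
    · exact absurd (h ▸ hch q) hufk'
    · exact absurd h (jJ q).2
    · exact h
  have hprod1 : ∏ q, uf (jJ q).1 ^ a (jJ q).1 = uf i₀ ^ a i₀ := by
    rw [Finset.prod_eq_single q₀ (fun q _ hq => absurd (hjJ (Subtype.ext ((hall_q q).trans hq₀.symm))) hq)
      (fun h => absurd (Finset.mem_univ _) h), hq₀]
  -- the sides other than `c_{i₀}` do not pass through `x'`
  have hpass : ∀ k, k ≠ i₀ → Ideal.span {(σ.stalkMap x').hom (c k)} = (maximalIdeal (X.presheaf.stalk (σ x'))).map (σ.stalkMap x').hom := by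
    intro k hk
    rcases huniv k with rfl | rfl | rfl
    · rw [hrel, Ideal.span_singleton_mul_right_unit (IsLocalRing.notMem_maximalIdeal.mp hufk'), hEi]
    · exact hEi
    · exact absurd rfl hk
  -- the transform: `U' · ε^{a_{i₀}} · E^{Σ a}`
  set U' : X'.presheaf.stalk x' := U * ↑v ^ (∑ k, a k) * ↑v⁻¹ ^ a i₀ with hU'
  have hU'u : IsUnit U' := (hU.mul ((Units.isUnit v).pow _)).mul ((Units.isUnit v⁻¹).pow _)
  have heq' : (σ.stalkMap x').hom (V * ∏ k, c k ^ a k) = U' * ε ^ a i₀ * ∏ j : Fin 1, (![E] j) ^ (![∑ k, a k] j) := by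
    rw [heq, hprod1, hufi₀, ← hv, mul_pow, mul_pow, Fin.prod_univ_one]
    simp only [Matrix.cons_val_zero]
    ring
  obtain ⟨hcc', hrep'⟩ := rep_functionFieldMap x' hcc hrep
  rw [heq'] at hrep'
  -- (II) `(E, ε, ζ) = 𝔪_{x'}`: the normal form for the regular system `(z, c_i, c_{i₀})`
  have htriple : Ideal.span ({E, ε, ζ} : Set (X'.presheaf.stalk x')) = maximalIdeal (X'.presheaf.stalk x') := by
    have hc'span : Ideal.span (Set.range ![z, c i, c i₀]) = maximalIdeal (X.presheaf.stalk (σ x')) := by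
      rw [← hz i hii₀]
      congr 1
      ext t
      simp only [Set.mem_range, Set.mem_insert_iff, Set.mem_singleton_iff]
      constructor
      · rintro ⟨j, rfl⟩
        fin_cases j <;> simp
      · rintro (rfl | rfl | rfl)
        exacts [⟨0, rfl⟩, ⟨1, rfl⟩, ⟨2, rfl⟩]
    have hz0' : Ideal.span (Set.range (Fin.append ![z, c i, c i₀] Fin.elim0)) = maximalIdeal (X.presheaf.stalk (σ x')) := by
      rw [span_range_append_elim0_eq, hc'span]
    obtain ⟨i₂, uf', m', jJ', hrel', hufi', hjJ', -, hcomplete', hrsop', -⟩ :=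
      exists_transform_normalForm_of_isBlowup hσ x' hR ![z, c i, c i₀] Fin.elim0 hz0' hdim0 (hc'span.trans hJ.symm) (fun _ => 0)
        Fin.elim0 isUnit_one
    have hei' : (σ.stalkMap x').hom (![z, c i, c i₀] i₂) ≠ 0 := by simpa using hrsop'.ne_zero 0
    have hEi' : Ideal.span {(σ.stalkMap x').hom (![z, c i, c i₀] i₂)} =
        (maximalIdeal (X.presheaf.stalk (σ x'))).map (σ.stalkMap x').hom := by
      rw [← hc'span]; exact span_singleton_eq_map_span_of_rel _ _ i₂ uf' hrel'
    obtain ⟨v', hv'⟩ : Associated E ((σ.stalkMap x').hom (![z, c i, c i₀] i₂)) :=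
      Ideal.span_singleton_eq_span_singleton.mp (hE.trans hEi'.symm)
    -- `uf'_0 = v'⁻¹ ζ`, `uf'_2 = v'⁻¹ ε`
    have h0 : uf' 0 = ↑v'⁻¹ * ζ := by
      have h1 : E * (↑v' * uf' 0) = E * ζ := by
        rw [← mul_assoc, hv', ← hrel' 0, ← hζ]; rfl
      rw [← mul_left_cancel₀ hE0 h1, ← mul_assoc, Units.inv_mul, one_mul]
    have h2 : uf' 2 = ↑v'⁻¹ * ε := by
      have h1 : E * (↑v' * uf' 2) = E * ε := by
        rw [← mul_assoc, hv', ← hrel' 2, ← hε]; rfl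
      rw [← mul_left_cancel₀ hE0 h1, ← mul_assoc, Units.inv_mul, one_mul]
    have h0m : uf' 0 ∈ maximalIdeal (X'.presheaf.stalk x') := by rw [h0]; exact Ideal.mul_mem_left _ _ hζm
    have h2m : uf' 2 ∈ maximalIdeal (X'.presheaf.stalk x') := by rw [h2]; exact Ideal.mul_mem_left _ _ hεm
    have hone : (1 : X'.presheaf.stalk x') ∉ maximalIdeal (X'.presheaf.stalk x') := fun h =>
      (maximalIdeal.isMaximal _).ne_top (Ideal.eq_top_of_isUnit_mem _ h isUnit_one)
    have hi₂0 : i₂ ≠ 0 := by rintro rfl; rw [hufi'] at h0m; exact hone h0m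
    have hi₂2 : i₂ ≠ 2 := by rintro rfl; rw [hufi'] at h2m; exact hone h2m
    obtain ⟨q₁, hq₁⟩ := hcomplete' 0 (Ne.symm hi₂0) h0m
    obtain ⟨q₂, hq₂⟩ := hcomplete' 2 (Ne.symm hi₂2) h2m
    have hq12 : q₁ ≠ q₂ := by
      intro h
      have h1 : ((jJ' q₁).1 : Fin 3) = (jJ' q₂).1 := by rw [h]
      rw [hq₁, hq₂] at h1
      exact absurd h1 (by decide)
    -- the triple `(σ^♯ c'_{i₂}, uf'_0, uf'_2)` is part of a regular system of parameters
    have h3 : IsRsopPart ![(σ.stalkMap x').hom (![z, c i, c i₀] i₂), uf' 0, uf' 2] := by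
      have hinj : Function.Injective (![0, Fin.succ (Fin.castAdd 0 q₁), Fin.succ (Fin.castAdd 0 q₂)] : Fin 3 → Fin (m' + 0 + 1)) := by
        have hne12 : Fin.succ (Fin.castAdd 0 q₁) ≠ Fin.succ (Fin.castAdd 0 q₂) := fun h =>
          hq12 (Fin.castAdd_injective _ _ (Fin.succ_injective _ h))
        intro t₁ t₂ h
        fin_cases t₁ <;> fin_cases t₂
        all_goals (first | rfl | (exfalso; simp only [Fin.zero_eta, Fin.mk_one, Fin.reduceFinMk, Matrix.cons_val_zero, Matrix.cons_val_one,
          Matrix.cons_val_two, Matrix.tail_cons, Matrix.head_cons] at h; first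
            | exact Fin.succ_ne_zero _ h | exact Fin.succ_ne_zero _ h.symm | exact hne12 h | exact hne12 h.symm))
      have h1 := hrsop'.comp _ hinj
      have h4 : (Fin.cons ((σ.stalkMap x').hom (![z, c i, c i₀] i₂))
          (Fin.append (fun q => uf' (jJ' q).1) fun m'' => (σ.stalkMap x').hom (Fin.elim0 m'' : X.presheaf.stalk (σ x'))) :
          Fin (m' + 0 + 1) → X'.presheaf.stalk x') ∘
          (![0, Fin.succ (Fin.castAdd 0 q₁), Fin.succ (Fin.castAdd 0 q₂)] : Fin 3 → Fin (m' + 0 + 1)) =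
          ![(σ.stalkMap x').hom (![z, c i, c i₀] i₂), uf' 0, uf' 2] := by
        funext t
        fin_cases t
        · rfl
        · simp only [Function.comp_apply, Fin.mk_one, Matrix.cons_val_one, Matrix.cons_val_zero, Fin.cons_succ, Fin.append_left, hq₁]
        · simp only [Function.comp_apply, Fin.reduceFinMk, Matrix.cons_val, Fin.cons_succ, Fin.append_left, hq₂]
      rw [h4] at h1
      exact h1
    have h4 : IsRsopPart ![E, ζ, ε] := by
      refine h3.of_associated fun t => ?_
      fin_cases t
      · change Associated ((σ.stalkMap x').hom (![z, c i, c i₀] i₂)) E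
        exact ⟨v'⁻¹, by rw [← hv', mul_assoc, Units.mul_inv, mul_one]⟩
      · change Associated (uf' 0) ζ
        exact ⟨v', by rw [h0, mul_comm, ← mul_assoc, Units.mul_inv, one_mul]⟩
      · change Associated (uf' 2) ε
        exact ⟨v', by rw [h2, mul_comm, ← mul_assoc, Units.mul_inv, one_mul]⟩
    rw [← span_triple_eq_maximalIdeal_of_isRsopPart h4 hdim']
    congr 1
    ext t
    simp only [Set.mem_insert_iff, Set.mem_singleton_iff]
    tauto
  -- (III) the side family `(ε; E)` at `x'`: one transversal side
  have hzz2 : Ideal.span ({ε, ζ, E} : Set (X'.presheaf.stalk x')) = maximalIdeal (X'.presheaf.stalk x') := by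
    rw [← htriple]
    congr 1
    ext t
    simp only [Set.mem_insert_iff, Set.mem_singleton_iff]
    tauto
  have hrsop2 : IsRsopPart (Fin.cons ε ![E] : Fin 2 → X'.presheaf.stalk x') := by
    have h1 := (isRsopPart_vecCons_three_of_span_triple hR' hdim' hzz2).comp (![0, 2] : Fin 2 → Fin 3) (by decide)
    have h2 : (![ε, ζ, E] : Fin 3 → X'.presheaf.stalk x') ∘ (![0, 2] : Fin 2 → Fin 3) = (Fin.cons ε ![E] : Fin 2 → X'.presheaf.stalk x') := by
      funext t; fin_cases t <;> rfl
    rwa [h2] at h1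
  refine ⟨htriple, hpass, U', hU'u, ?_, ?_⟩
  · rw [hrep', Fin.prod_univ_one]
    simp only [Matrix.cons_val_zero]
  rcases cleanPermissibleAt_or_obstruction_of_sideFamily_general (RatFn.toFunctionField x') (RatFn.toFunctionField_injective x') hdim' hzz2
      hrsop2 _ hcc' hU'u (a i₀) ![∑ k, a k] hrep' with h | ⟨j₁, j₂, hne, -⟩ | ⟨j, -, -, hmem⟩ | ⟨hA, hS, hnb⟩
  · exact Or.inl h
  · exact absurd (Subsingleton.elim j₁ j₂) hne
  · exfalso
    have hj : j = 0 := Subsingleton.elim j 0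
    subst hj
    exact not_mem_span_pair_sup_sq_of_span_triple hR' hdim' hzz2 (by simpa using hmem)
  · exact Or.inr ⟨hA, by simpa using hS 0, hnb⟩

/-- **One insertion resolves a vertex obstruction when an exponent in sight is prime to `p`**: in the same setting, if `p ∤ a_{i₀}` or `p ∤ Σ_k a_k`,
the strict transform `N' = (ε, ζ)` is clean-permissible at `x'`. [cite: CossartPiltant2008, Lemma 4.3 (5)] [cite: Piltant2013, §2 Axiom 4] -/
theorem cleanPermissibleAt_strictTransform_of_vertex [Fact p.Prime] [CharP X'.functionField p] (hσ : IsBlowup σ J) (x' : X')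
    (hR : IsRegularLocalRing (X.presheaf.stalk (σ x'))) (c : Fin 3 → X.presheaf.stalk (σ x'))
    (hc : Ideal.span (Set.range c) = maximalIdeal (X.presheaf.stalk (σ x')))
    (hdim : ringKrullDim (X.presheaf.stalk (σ x')) = (3 : ℕ)) (hJ : stalkIdeal J (σ x') = maximalIdeal (X.presheaf.stalk (σ x')))
    {G : X.functionField} {cc : Fin p → X.functionField} (hcc : ∃ j : Fin p, (j : ℕ) ≠ 0 ∧ cc j ≠ 0)
    {V : X.presheaf.stalk (σ x')} (hV : IsUnit V) (a : Fin 3 → ℕ)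
    (hrep : (∑ j : Fin p, cc j ^ p * G ^ (j : ℕ)) = RatFn.toFunctionField (σ x') (V * ∏ k, c k ^ a k))
    (i₀ : Fin 3) (hexp : ¬ p ∣ a i₀ ∨ ¬ p ∣ ∑ k, a k) {z : X.presheaf.stalk (σ x')}
    (hz : ∀ k, k ≠ i₀ → Ideal.span ({z, c k, c i₀} : Set (X.presheaf.stalk (σ x'))) = maximalIdeal (X.presheaf.stalk (σ x')))
    (hdim' : ringKrullDim (X'.presheaf.stalk x') = 3) {E ε ζ : X'.presheaf.stalk x'}
    (hE : Ideal.span {E} = (maximalIdeal (X.presheaf.stalk (σ x'))).map (σ.stalkMap x').hom)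
    (hε : (σ.stalkMap x').hom (c i₀) = E * ε) (hεm : ε ∈ maximalIdeal (X'.presheaf.stalk x'))
    (hζ : (σ.stalkMap x').hom z = E * ζ) (hζm : ζ ∈ maximalIdeal (X'.presheaf.stalk x')) :
    CleanPermissibleAt p (RatFn.toFunctionField x') (RatFn.functionFieldMap σ G) (Ideal.span ({ε, ζ} : Set (X'.presheaf.stalk x'))) := by
  obtain ⟨-, -, U, -, -, h⟩ := cleanPermissibleAt_strictTransform_of_vertex_or_birth hσ x' hR c hc hdim hJ hcc hV a hrep i₀ hz hdim' hE hε hεm hζ hζm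
  rcases h with h | ⟨h₁, h₂, -⟩
  · exact h
  · exact absurd h₂ (hexp.resolve_left (not_not.mpr h₁))

end Scheme

end Summit.ResolutionOfSingularities.ResolutionOfSingularities.Theorems.RadicialJung.CleanModels

end
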